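import Mathlib
import Literature.NumberTheory.Transcendental.BakerLinearFormsQuantitativeProofs
import Literature.Barriers.Schanuel.LargeTranscendenceDegreeHolds
import Literature.Barriers.Schanuel.LargeTranscendenceDegreeProofs
import Literature.NumberTheory.Transcendental.DiazGrid
import Literature.NumberTheory.Transcendental.OneMotiveToricProofs

/-!
# The Technical Hypothesis for the powers of `2πi` and the Hankel bound (stub `stub_piPowersTH`)

Registered stub `stub_piPowersTH` of line `kernel-tower-relative-lw` of crux `stmt-Schanuel-0970`
(`Summit.Schanuel.Schanuel.Theses.RigidCore.SchanuelOnLogFreeCore`).  The line reads the log-free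
core `C_EA` through Kirby's kernel tower, whose level `0` is `ℚ(2πi)^{ralg}`; this file is the
line's level-`0` CALIBRATION deliverable (off the path to the crux).  Write `τ = 2πi`.  We prove,
unconditionally:

* `KernelTower.exists_rootDist_lowerBound` — **a transcendence measure for `2πi`**: for every
  `d ≥ 1` there is `k` such that for every non-zero `P ∈ ℤ[X]` of degree `≤ d` and height `≤ H`
  (`H ≥ 1`) and every complex root `ρ` of `P`, `|2πi − ρ| > (2H)^{-k}`.  This is A. Baker,
  *Transcendental Number Theory* (1975), Ch. 3, Theorem 3.1 in the case `n = 1`, `α₁ = -1`,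
  `log α₁ = πi`, `β₁ = -2`, `β₀ = ρ` ("more especially `|π − β| > B^{-C}`", loc. cit. p. 28), read
  off the tree's PROVED `Literature.NumberTheory.Transcendental.baker1975_thm_3_1_holds` through its
  corollary `baker1975_thm_3_1.pi_case`; the alternative `ρ − 2πi = 0` is excluded by Lindemann
  (`transcendental_two_pi_I`).
* `KernelTower.norm_aeval_two_pi_I_lowerBound` — the classical **transcendence measure of `π` in
  fixed degree** (Baker 1975 p. 28; N. I. Fel'dman 1960): for every `d` there are `c > 0` and `k`
  with `c ≤ (∑ᵢ |hᵢ|)^k · |∑_{i<d} hᵢ (2πi)^i|` for all non-zero `h ∈ ℤ^d` — from the root bound by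
  multiplying over the complex roots of `P_h = ∑ hᵢ Xⁱ` (`|P_h(τ)| = |lead| · ∏_ρ |τ − ρ|`).
* `stub_piPowersTH` (signature verbatim) — the **Technical Hypothesis** (Yu. V. Nesterenko,
  P. Philippon (eds.), LNM 1752 (2001), Ch. 14, Definition 2.6) for `(1, τ, …, τ^{d-1})`, by the
  tree's `TechnicalHypothesis.of_lowerBound` (a polynomial lower bound implies (T.H.)), exactly as
  the tree's `technicalHypothesis_pow` does for the powers of an algebraic number with Liouville's
  inequality.
* `KernelTower.hankel_bound` — **Diaz's Theorem 2.7 made unconditional on the kernel Hankel grid**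
  `x = y = (1, τ, …, τ^{d-1})` (LNM 1752, Ch. 14, Theorem 2.7, clause `t₂`, PROVED in the tree as
  `Literature.Barriers.Schanuel.LargeTranscendenceDegree_holds`): for `d ≥ 3`,
  `⌈d²/(2d)⌉ = ⌈d/2⌉ ≤ trdeg_ℚ ℚ(τ^i, e^{τ^{i+j}})`; and `KernelTower.hankel_bound_explicit`, the
  same bound for the explicit field `ℚ(2πi, e^{(2πi)^k} : k ≤ 2d − 2)`.

No definition is introduced; auxiliaries live in the sub-namespace `…RigidCore.KernelTower`, only
the registered stub is declared directly in `Summit.Schanuel.Schanuel.Theorems.RigidCore`.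

## References

* A. Baker, *Transcendental Number Theory*, Cambridge University Press (1975), Ch. 3, Theorem 3.1
  (p. 27) and the corollary `|π − β| > B^{-C}` (p. 28). [BakerTNT1975]
* N. I. Fel'dman, *On the measure of transcendence of the number `π`*, Izv. Akad. Nauk SSSR
  Ser. Mat. 24 (1960), 357–368 (the classical transcendence measure of `π`).
* Yu. V. Nesterenko, P. Philippon (eds.), *Introduction to Algebraic Independence Theory*,
  LNM 1752, Springer (2001), Ch. 14, Definition 2.6 and Theorem 2.7. [NesterenkoPhilippon2001]
-/

noncomputable section

namespace Summit.Schanuel.Schanuel.Theorems.RigidCore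

open Polynomial
open Literature.NumberTheory.Transcendental (baker1975_thm_3_1_holds transcendental_two_pi_I)

namespace KernelTower

/-! ### The integer polynomial `P_h = ∑_{i<d} hᵢ Xⁱ` of a coefficient vector `h ∈ ℤ^d` -/

/-- Coefficients of `P_h = ∑_{j<d} h_j X^j`: the `k`-th coefficient is `h_k` for `k < d` and `0`
otherwise. [folklore] -/
theorem coeff_sum_monomial {d : ℕ} (h : Fin d → ℤ) (k : ℕ) :
    (∑ j : Fin d, monomial (j : ℕ) (h j)).coeff k = if hk : k < d then h ⟨k, hk⟩ else 0 := by
  simp only [finsetSum_coeff, coeff_monomial]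
  split_ifs with hk
  · rw [Finset.sum_eq_single ⟨k, hk⟩]
    · simp
    · intro b _ hb
      rw [if_neg]
      exact fun e => hb (Fin.ext e)
    · intro hn
      exact absurd (Finset.mem_univ _) hn
  · exact Finset.sum_eq_zero fun j _ => if_neg (by omega)

/-- `P_h ≠ 0` for `h ≠ 0` (compare coefficients). [folklore] -/
theorem sum_monomial_ne_zero {d : ℕ} {h : Fin d → ℤ} (hh : h ≠ 0) :
    (∑ j : Fin d, monomial (j : ℕ) (h j)) ≠ 0 := by
  obtain ⟨i, hi⟩ : ∃ i, h i ≠ 0 := Function.ne_iff.mp hh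
  intro h0
  have hc := coeff_sum_monomial h i
  rw [h0, coeff_zero, dif_pos i.is_lt] at hc
  exact hi (by simpa using hc.symm)

/-- `deg P_h ≤ d` (indeed `< d`). [folklore] -/
theorem natDegree_sum_monomial_le {d : ℕ} (h : Fin d → ℤ) :
    (∑ j : Fin d, monomial (j : ℕ) (h j)).natDegree ≤ d :=
  natDegree_sum_le_of_forall_le _ _ fun j _ => (natDegree_monomial_le _).trans j.is_lt.le

/-- The height of `P_h` is at most `∑ |h_j|`. [folklore] -/
theorem abs_coeff_sum_monomial_le {d : ℕ} (h : Fin d → ℤ) (k : ℕ) :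
    |(∑ j : Fin d, monomial (j : ℕ) (h j)).coeff k| ≤ ∑ j, |h j| := by
  rw [coeff_sum_monomial]
  split_ifs with hk
  · exact Finset.single_le_sum (f := fun j => |h j|) (fun j _ => abs_nonneg _) (Finset.mem_univ _)
  · rw [abs_zero]
    exact Finset.sum_nonneg fun j _ => abs_nonneg _

/-- `P_h(z) = ∑ h_j z^j`. [folklore] -/
theorem aeval_sum_monomial {d : ℕ} (h : Fin d → ℤ) (z : ℂ) :
    aeval z (∑ j : Fin d, monomial (j : ℕ) (h j)) = ∑ j, (h j : ℂ) * z ^ (j : ℕ) := by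
  simp [map_sum, aeval_monomial]

/-! ### Baker's theorem: the distance from `2πi` to an algebraic number -/

/-- **Transcendence measure for `2πi`, root form** (Baker 1975, Ch. 3, Thm 3.1 with `n = 1`,
`α₁ = -1`, `log α₁ = πi`; "`|π − β| > B^{-C}`", p. 28): for every `d ≥ 1` there is `k ∈ ℕ` such
that for every non-zero `P ∈ ℤ[X]` with `deg P ≤ d` and all `|coeff| ≤ H`, `H ≥ 1`, and every
complex root `ρ` of `P`, `(2H)^{-k} < |2πi − ρ|`.  (Apply Theorem 3.1 to `β₀ = ρ` (witness `P`) and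
`β₁ = -2` (witness `X + 2`) with `B = 2H`: the form `β₀ + β₁ πi = ρ − 2πi` is non-zero because
`2πi` is transcendental, so `|ρ − 2πi| > B^{-C} ≥ B^{-⌈C⌉}`.)
[cite: BakerTNT1975, Ch. 3 Thm 3.1 and p. 28] -/
theorem exists_rootDist_lowerBound {d : ℕ} (hd : 1 ≤ d) :
    ∃ k : ℕ, ∀ P : ℤ[X], P ≠ 0 → P.natDegree ≤ d → ∀ H : ℕ, 1 ≤ H →
      (∀ j, |P.coeff j| ≤ (H : ℤ)) → ∀ ρ : ℂ, aeval ρ P = 0 →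
        (((2 * H : ℕ) : ℝ) ^ k)⁻¹ < ‖(2 * ↑Real.pi * Complex.I : ℂ) - ρ‖ := by
  obtain ⟨C₀, -, hBaker⟩ := baker1975_thm_3_1_holds.pi_case d 1 le_rfl hd
  refine ⟨⌈C₀⌉₊, fun P hP0 hPd H hH hPc ρ hρ => ?_⟩
  have hB2 : 2 ≤ 2 * H := by omega
  -- the coefficient vector `β = (ρ, -2)` and its witnesses `P`, `X + 2`
  let β : Fin 2 → ℂ := ![ρ, -2]
  have hwit : ∀ j, ∃ Q : ℤ[X], Q ≠ 0 ∧ Q.natDegree ≤ d ∧ (∀ k, |Q.coeff k| ≤ ((2 * H : ℕ) : ℤ)) ∧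
      aeval (β j) Q = 0 := by
    refine Fin.forall_fin_two.mpr ⟨⟨P, hP0, hPd, fun k => (hPc k).trans (by push_cast; omega), ?_⟩,
      ⟨X + C 2, X_add_C_ne_zero 2, by rw [natDegree_X_add_C]; exact hd, fun k => ?_, ?_⟩⟩
    · simpa [β] using hρ
    · rw [coeff_add, coeff_X, coeff_C]
      split_ifs <;> simp <;> omega
    · show aeval (-2 : ℂ) (X + C 2 : ℤ[X]) = 0
      rw [map_add, aeval_X, aeval_C, algebraMap_int_eq, eq_intCast]
      norm_num
  have hform : β 0 + ∑ i : Fin 1, β i.succ * (↑Real.pi * Complex.I) =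
      ρ - 2 * ↑Real.pi * Complex.I := by
    simp only [β, Fin.sum_univ_one, Fin.succ_zero_eq_one, Matrix.cons_val_zero, Matrix.cons_val_one]
    ring
  rcases hBaker (2 * H) hB2 β hwit with hzero | hlb
  · -- `ρ = 2πi` would make `2πi` algebraic
    exfalso
    rw [hform, sub_eq_zero] at hzero
    have halg : IsAlgebraic ℤ ρ := ⟨P, hP0, hρ⟩
    have halgQ : IsAlgebraic ℚ ρ := halg.extendScalars (algebraMap ℤ ℚ).injective_int
    exact transcendental_two_pi_I (hzero ▸ halgQ)
  · rw [hform, norm_sub_rev] at hlb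
    refine lt_of_le_of_lt ?_ hlb
    have hB1 : (1 : ℝ) ≤ ((2 * H : ℕ) : ℝ) := by exact_mod_cast (show 1 ≤ 2 * H by omega)
    rw [← Real.rpow_natCast, ← Real.rpow_neg (by positivity)]
    exact Real.rpow_le_rpow_of_exponent_le hB1 (neg_le_neg (Nat.le_ceil C₀))

/-! ### Product over the roots -/

/-- If every element `ρ` of a multiset `s` of card `≤ n` satisfies `a ≤ |z − ρ|` with
`0 ≤ a ≤ 1`, then `a^n ≤ |∏_{ρ ∈ s} (z − ρ)|`. [folklore] -/
theorem pow_le_norm_prod_sub {a : ℝ} (ha0 : 0 ≤ a) (ha1 : a ≤ 1) (z : ℂ) {s : Multiset ℂ}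
    (h : ∀ ρ ∈ s, a ≤ ‖z - ρ‖) {n : ℕ} (hn : s.card ≤ n) :
    a ^ n ≤ ‖(s.map fun ρ => z - ρ).prod‖ := by
  induction s using Multiset.induction_on generalizing n with
  | empty => simpa using pow_le_one₀ ha0 ha1
  | cons ρ s ih =>
    obtain ⟨m, rfl⟩ : ∃ m, n = m + 1 := ⟨n - 1, by rw [Multiset.card_cons] at hn; omega⟩
    rw [Multiset.map_cons, Multiset.prod_cons, norm_mul, pow_succ, mul_comm]
    rw [Multiset.card_cons] at hn
    exact mul_le_mul (h ρ (Multiset.mem_cons_self ρ s))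
      (ih (fun σ hσ => h σ (Multiset.mem_cons_of_mem hσ)) (by omega)) (pow_nonneg ha0 _)
      (norm_nonneg _)

/-- `|P(z)| = |lead P| · |∏_ρ (z − ρ)|` over the complex roots of an integer polynomial (`ℂ` is
algebraically closed). [folklore] -/
theorem norm_aeval_eq_mul_prod_roots (P : ℤ[X]) (z : ℂ) :
    ‖aeval z P‖ = ‖(P.leadingCoeff : ℂ)‖ *
      ‖((P.map (Int.castRingHom ℂ)).roots.map fun ρ => z - ρ).prod‖ := by
  set Pc : ℂ[X] := P.map (Int.castRingHom ℂ) with hPc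
  have hfac : C Pc.leadingCoeff * (Pc.roots.map fun a => X - C a).prod = Pc :=
    C_leadingCoeff_mul_prod_multiset_X_sub_C IsAlgClosed.card_roots_eq_natDegree
  have hev : aeval z P = Pc.leadingCoeff * (Pc.roots.map fun ρ => z - ρ).prod := by
    have e1 : aeval z P = Pc.eval z := by rw [hPc, eval_map, ← algebraMap_int_eq, ← aeval_def]
    rw [e1]
    conv_lhs => rw [← hfac]
    simp [eval_multiset_prod, Multiset.map_map]
  rw [hev, norm_mul, hPc, leadingCoeff_map_of_injective (Int.castRingHom ℂ).injective_int,
    eq_intCast]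

/-- Roots of `P.map ℤ → ℂ` are roots of `P`. [folklore] -/
theorem aeval_eq_zero_of_mem_roots {P : ℤ[X]} {ρ : ℂ} (hρ : ρ ∈ (P.map (Int.castRingHom ℂ)).roots) :
    aeval ρ P = 0 := by
  have h := (mem_roots'.1 hρ).2
  rwa [IsRoot.def, eval_map, ← algebraMap_int_eq, ← aeval_def] at h

/-! ### The transcendence measure of `π` in fixed degree -/

/-- **Transcendence measure of `2πi` (equivalently of `π`) in fixed degree** — the classical
measure `|P(π)| > H^{-C(d)}` for `0 ≠ P ∈ ℤ[X]`, `deg P ≤ d`, height `≤ H` (Baker 1975, p. 28, from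
Theorem 3.1; originally N. I. Fel'dman 1960), in the packaging consumed by
`TechnicalHypothesis.of_lowerBound`: for every `d` there are `c > 0` and `k ∈ ℕ` with
`c ≤ (∑ᵢ |hᵢ|)^k · |∑_{i<d} hᵢ (2πi)^i|` for every non-zero `h ∈ ℤ^d`.  Proof: with `H = ∑|hᵢ|` and
`P_h = ∑ hᵢ Xⁱ = lead · ∏_ρ (X − ρ)` over `ℂ` (at most `d` roots, `|lead| ≥ 1`), each factor
satisfies `|2πi − ρ| > (2H)^{-k₁}` (`exists_rootDist_lowerBound`), so
`|P_h(2πi)| ≥ (2H)^{-k₁ d}`; take `k = k₁ d`, `c = 2^{-k}`.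
[cite: BakerTNT1975, Ch. 3 Thm 3.1 and p. 28] -/
theorem norm_aeval_two_pi_I_lowerBound (d : ℕ) :
    ∃ c : ℝ, 0 < c ∧ ∃ k : ℕ, ∀ h : Fin d → ℤ, h ≠ 0 →
      c ≤ (∑ i, |(h i : ℝ)|) ^ k * ‖∑ i, (h i : ℂ) * (2 * ↑Real.pi * Complex.I : ℂ) ^ (i : ℕ)‖ := by
  rcases Nat.eq_zero_or_pos d with rfl | hd
  · exact ⟨1, one_pos, 0, fun h hh => (hh (Subsingleton.elim _ _)).elim⟩
  obtain ⟨k₁, hk₁⟩ := exists_rootDist_lowerBound (Nat.succ_le_of_lt hd)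
  refine ⟨((2 : ℝ) ^ (k₁ * d))⁻¹, by positivity, k₁ * d, fun h hh => ?_⟩
  set τ : ℂ := 2 * ↑Real.pi * Complex.I with hτ
  set P : ℤ[X] := ∑ j : Fin d, monomial (j : ℕ) (h j) with hP
  set H : ℕ := ∑ i, (h i).natAbs with hH
  have hP0 : P ≠ 0 := sum_monomial_ne_zero hh
  -- the height: `H = ∑ |hᵢ| ≥ 1`
  have hHZ : (H : ℤ) = ∑ i, |h i| := by
    rw [hH]; push_cast [Int.natCast_natAbs]; rfl
  have hHR : (H : ℝ) = ∑ i, |(h i : ℝ)| := by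
    have : ((H : ℤ) : ℝ) = ((∑ i, |h i| : ℤ) : ℝ) := by rw [hHZ]
    push_cast at this
    exact this
  have hH1 : 1 ≤ H := by
    obtain ⟨i, hi⟩ : ∃ i, h i ≠ 0 := Function.ne_iff.mp hh
    have h1 : 1 ≤ (h i).natAbs := Int.natAbs_pos.mpr hi
    exact h1.trans (Finset.single_le_sum (f := fun j => (h j).natAbs) (fun j _ => Nat.zero_le _)
      (Finset.mem_univ i))
  have hcoeff : ∀ j, |P.coeff j| ≤ (H : ℤ) := fun j => by
    rw [hHZ]; exact abs_coeff_sum_monomial_le h j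
  -- each complex root `ρ` of `P` is far from `τ`
  set a : ℝ := (((2 * H : ℕ) : ℝ) ^ k₁)⁻¹ with ha
  have h2H1 : (1 : ℝ) ≤ ((2 * H : ℕ) : ℝ) := by exact_mod_cast (show 1 ≤ 2 * H by omega)
  have ha0 : 0 ≤ a := by positivity
  have ha1 : a ≤ 1 := inv_le_one_of_one_le₀ (one_le_pow₀ h2H1)
  have hroots : ∀ ρ ∈ (P.map (Int.castRingHom ℂ)).roots, a ≤ ‖τ - ρ‖ := fun ρ hρ =>
    (hk₁ P hP0 (natDegree_sum_monomial_le h) H hH1 hcoeff ρ (aeval_eq_zero_of_mem_roots hρ)).le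
  have hcard : (P.map (Int.castRingHom ℂ)).roots.card ≤ d :=
    (card_roots' _).trans ((natDegree_map_le).trans (natDegree_sum_monomial_le h))
  have hprod := pow_le_norm_prod_sub ha0 ha1 τ hroots hcard
  -- `|lead P| ≥ 1`
  have hlead : (1 : ℝ) ≤ ‖(P.leadingCoeff : ℂ)‖ := by
    rw [Complex.norm_intCast]
    exact_mod_cast Int.one_le_abs (leadingCoeff_ne_zero.mpr hP0)
  have hval : a ^ d ≤ ‖∑ i, (h i : ℂ) * τ ^ (i : ℕ)‖ := by
    rw [← aeval_sum_monomial, norm_aeval_eq_mul_prod_roots]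
    calc a ^ d ≤ 1 * ‖(((P.map (Int.castRingHom ℂ)).roots.map fun ρ => τ - ρ).prod)‖ := by
          rw [one_mul]; exact hprod
      _ ≤ _ := mul_le_mul_of_nonneg_right hlead (norm_nonneg _)
  -- packaging: `a^d = (2H)^{-k₁ d} = 2^{-k} H^{-k}`
  have hHpos : (0 : ℝ) < H := by exact_mod_cast hH1
  have hak : a ^ d = ((2 : ℝ) ^ (k₁ * d))⁻¹ * ((H : ℝ) ^ (k₁ * d))⁻¹ := by
    rw [ha, Nat.cast_mul, Nat.cast_two, inv_pow, ← pow_mul, mul_pow, mul_inv]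
  rw [← hHR]
  calc ((2 : ℝ) ^ (k₁ * d))⁻¹ = (H : ℝ) ^ (k₁ * d) * a ^ d := by
        rw [hak, mul_left_comm, mul_inv_cancel₀ (pow_ne_zero _ hHpos.ne'), mul_one]
    _ ≤ (H : ℝ) ^ (k₁ * d) * ‖∑ i, (h i : ℂ) * τ ^ (i : ℕ)‖ :=
        mul_le_mul_of_nonneg_left hval (pow_nonneg hHpos.le _)

/-- The powers `1, τ, …, τ^{d-1}` of `τ = 2πi` are `ℚ`-linearly independent (`2πi` is
transcendental). [folklore] -/
theorem linearIndependent_two_pi_I_pow (d : ℕ) :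
    LinearIndependent ℚ (fun i : Fin d => (2 * ↑Real.pi * Complex.I : ℂ) ^ (i : ℕ)) := by
  rw [Fintype.linearIndependent_iff]
  intro g hg l
  set p : ℚ[X] := ∑ i : Fin d, monomial (i : ℕ) (g i) with hp
  have hpt : aeval (2 * ↑Real.pi * Complex.I : ℂ) p = 0 := by
    simp only [hp, map_sum, aeval_monomial, ← Algebra.smul_def]
    exact hg
  have hp0 : p = 0 := by
    by_contra hne
    exact transcendental_two_pi_I ⟨p, hne, hpt⟩
  have hcoeff : p.coeff (l : ℕ) = g l := by
    simp only [hp, finsetSum_coeff, coeff_monomial]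
    rw [Finset.sum_eq_single l]
    · simp
    · intro b _ hb
      rw [if_neg]
      exact fun h => hb (Fin.ext h)
    · intro h; exact absurd (Finset.mem_univ l) h
  rw [← hcoeff, hp0, coeff_zero]

end KernelTower

/-! ## The registered stub -/

/-- **Registered stub `stub_piPowersTH` of line `kernel-tower-relative-lw`** (signature verbatim):
the powers `1, 2πi, …, (2πi)^{d-1}` satisfy the Technical Hypothesis of Nesterenko–Philippon,
LNM 1752, Ch. 14, Definition 2.6 (`∀ ε > 0 ∃ H₀ ∀ H ≥ H₀ ∀ h ∈ ℤ^d ∖ 0, |hᵢ| ≤ H ⟹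
|∑ hᵢ (2πi)^i| ≥ exp (−H^ε)`).  Proof: the transcendence measure
`KernelTower.norm_aeval_two_pi_I_lowerBound` (Baker 1975, Thm 3.1) is a polynomial lower bound,
and a polynomial lower bound implies (T.H.) (`TechnicalHypothesis.of_lowerBound`); the barrier's
`TechnicalHypothesis` is the tree's by `technicalHypothesis_iff_transcendental`.
[cite: BakerTNT1975, Ch. 3 Thm 3.1 and p. 28] -/
theorem stub_piPowersTH :
    ∀ d : ℕ, Literature.Barriers.Schanuel.TechnicalHypothesis
      (fun i : Fin d => (2 * ↑Real.pi * Complex.I : ℂ) ^ (i : ℕ)) := by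
  intro d
  obtain ⟨c, hc, k, hb⟩ := KernelTower.norm_aeval_two_pi_I_lowerBound d
  exact (Literature.Barriers.Schanuel.technicalHypothesis_iff_transcendental _).mpr
    (Literature.NumberTheory.Transcendental.TechnicalHypothesis.of_lowerBound hc (k := k) hb)

/-! ## The unconditional Hankel bound -/

/-- **Hankel bound** — Diaz's Theorem 2.7 (Nesterenko–Philippon (eds.), LNM 1752, Ch. 14,
Theorem 2.7, clause `t₂`; PROVED in the tree as `LargeTranscendenceDegree_holds`) made
UNCONDITIONAL on the kernel Hankel grid `x = y = (1, 2πi, …, (2πi)^{d-1})`: for `d ≥ 3`,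
`⌈d²/(2d)⌉ = ⌈d/2⌉ ≤ trdeg_ℚ ℚ(2πi, e^{(2πi)^k} : k ≤ 2d − 2)` (the field `gridField₂ x x` is
generated by the `(2πi)^i` and the `e^{(2πi)^{i+j}}`).  For `d = 3, 4` the value `2` is already
Theorem 2.9 of loc. cit.; the first new value is `3` at `d = 5`.  Schanuel's conjecture (indeed the
line's `RelLW₀`) predicts `2d − 1`.  Both inputs of Theorem 2.7 are now theorems: linear
independence of the powers of `2πi` (Lindemann) and (T.H.) for them (`stub_piPowersTH`, Baker).
[cite: NesterenkoPhilippon2001, Ch. 14 Thm 2.7] -/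
theorem KernelTower.hankel_bound {d : ℕ} (hd : 3 ≤ d) :
    ((⌈((d * d : ℕ) : ℚ) / ((d + d : ℕ) : ℚ)⌉₊ : ℕ) : Cardinal) ≤
      Algebra.trdeg ℚ ↥(Literature.Barriers.Schanuel.gridField₂
        (fun i : Fin d => (2 * ↑Real.pi * Complex.I : ℂ) ^ (i : ℕ))
        (fun i : Fin d => (2 * ↑Real.pi * Complex.I : ℂ) ^ (i : ℕ))) :=
  Literature.Barriers.Schanuel.ceil_le_trdeg_gridField₂ _ _
    (KernelTower.linearIndependent_two_pi_I_pow d) (stub_piPowersTH d)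
    (KernelTower.linearIndependent_two_pi_I_pow d) (stub_piPowersTH d) (by nlinarith)

/-- The kernel Hankel grid field `gridField₂ x x`, `x = (1, τ, …, τ^{d-1})`, `τ = 2πi`, is contained
in the explicit field `ℚ(τ, e^{τ^k} : k < 2d − 1)` (its generators are the `τ^i` and the
`e^{τ^{i+j}}`, `i + j ≤ 2d − 2`). [folklore] -/
theorem KernelTower.gridField₂_le_explicit (d : ℕ) :
    Literature.Barriers.Schanuel.gridField₂
        (fun i : Fin d => (2 * ↑Real.pi * Complex.I : ℂ) ^ (i : ℕ))
        (fun i : Fin d => (2 * ↑Real.pi * Complex.I : ℂ) ^ (i : ℕ)) ≤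
      IntermediateField.adjoin ℚ ({(2 * ↑Real.pi * Complex.I : ℂ)} ∪
        Set.range (fun k : Fin (2 * d - 1) =>
          Complex.exp ((2 * ↑Real.pi * Complex.I : ℂ) ^ (k : ℕ)))) := by
  set τ : ℂ := 2 * ↑Real.pi * Complex.I with hτ
  set E := IntermediateField.adjoin ℚ ({τ} ∪
    Set.range (fun k : Fin (2 * d - 1) => Complex.exp (τ ^ (k : ℕ)))) with hE
  have hτE : τ ∈ E := IntermediateField.subset_adjoin _ _ (Set.mem_union_left _ rfl)
  rw [Literature.Barriers.Schanuel.gridField₂]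
  refine IntermediateField.adjoin_le_iff.mpr ?_
  rintro z ((⟨i, rfl⟩ | ⟨i, rfl⟩) | ⟨p, rfl⟩)
  · exact pow_mem hτE _
  · exact pow_mem hτE _
  · have hlt : (p.1 : ℕ) + (p.2 : ℕ) < 2 * d - 1 := by
      have h1 := p.1.is_lt; have h2 := p.2.is_lt; omega
    refine IntermediateField.subset_adjoin _ _ (Set.mem_union_right _ ⟨⟨_, hlt⟩, ?_⟩)
    simp [pow_add]

/-- **Hankel bound, explicit field**: for `d ≥ 3`,
`⌈d²/(2d)⌉ = ⌈d/2⌉ ≤ trdeg_ℚ ℚ(2πi, e^{(2πi)^k} : k ≤ 2d − 2)` — `KernelTower.hankel_bound`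
transported along `gridField₂ x x ≤ ℚ(2πi, e^{(2πi)^k} : k < 2d − 1)` by monotonicity of the
transcendence degree (`Literature.Barriers.Schanuel.trdeg_mono`).
[cite: NesterenkoPhilippon2001, Ch. 14 Thm 2.7] -/
theorem KernelTower.hankel_bound_explicit {d : ℕ} (hd : 3 ≤ d) :
    ((⌈((d * d : ℕ) : ℚ) / ((d + d : ℕ) : ℚ)⌉₊ : ℕ) : Cardinal) ≤
      Algebra.trdeg ℚ ↥(IntermediateField.adjoin ℚ ({(2 * ↑Real.pi * Complex.I : ℂ)} ∪
        Set.range (fun k : Fin (2 * d - 1) =>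
          Complex.exp ((2 * ↑Real.pi * Complex.I : ℂ) ^ (k : ℕ))))) :=
  (KernelTower.hankel_bound hd).trans
    (Literature.Barriers.Schanuel.trdeg_mono (KernelTower.gridField₂_le_explicit d))

end Summit.Schanuel.Schanuel.Theorems.RigidCore

end
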